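import Summits.AtomisticToContinuum.HydrodynamicLimit.Theorems.CollisionIsometryCLTCollisionalTransferLocalityEnvelopeA
import Summits.AtomisticToContinuum.HydrodynamicLimit.Theorems.CollisionIsometryCLTCollisionalTransferLocalityFmrRung0
import Summits.AtomisticToContinuum.HydrodynamicLimit.Theorems.CollisionIsometryCLTCollisionalTransferLocalityCeilingAllTimesRung0
import Summits.AtomisticToContinuum.HydrodynamicLimit.Theorems.CollisionIsometryCLTCollisionalTransferLocalityCompressibilityLinear
import HarnessLib

/-!
# [K0A]: the kinetic-correction value `KfunA` vanishes at global equilibrium (mesoscale kernel)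
(registered stub `stub_kfunA_const`, wave 3 of skeleton v19, line `hemisphere-affine-slaving`,
crux `CollisionalTransferLocality`, stmt-AtomisticToContinuum-9518)

Under the homogeneous local Gibbs law (`a₀ ≡ 1`, `u₀ ≡ 0`, `θ₀ ≡ θ > 0`) at small `σ`, for every flow
family, horizon `t > 0`, admissible kernel family, matrix weight `A` smooth on `[0, t]` and FIXED
`τ ∈ [0, t]`: `KfunA_N(z, τ) = ∫₀^τ∫ kinWA · p_c(ρ̄, θ̄) → 0` in probability.

Proof (the template `stub_weightedKineticRelaxationDilute`, …WeightedKineticRelaxationDilute, with the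
shorter integrand `kinWA A = (2/5)(D̄ : A)/pkin` — no `ū`/`q̄` part, hence no energy event).
* POINTWISE (`abs_kinWA_mul_pcoll_le_eps`): `p_c = pkin (Z(ρ̄σ³) − 1)` (`RhsEnvelope.pcoll_eq_pkin_mul`), so
  off the guard `pkin = 0` (where the product is `0`) `kinWA · p_c = (2/5)(D̄ : A)(Z − 1)`; with
  `|Z(η) − 1| ≤ Kη` on `[0, η_Z]` (`stub_hsCompressibility_linear`), `ρ̄σ³ ≤ η_Z` (dilute block),
  `|A_ab| ≤ C_A` and AM–GM `|D̄_ab| ≤ ε + (ΣD̄² + |q̄|²)/ε` (`abs_le_eps`):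
  `|kinWA · p_c| ≤ 4 C_A K η_Z (ε + (ΣD̄² + |q̄|²)/ε)`.
* IN `x` AND `s` (`norm_integral_kin_le`, `abs_KfunA_dilute_le`): honest dominating integrands (the
  kinetic integrand is measurable and bounded along a good orbit, `measurable_kineticIntegrand`,
  `kineticIntegrand_le`, `norm_vel_orbit_le`), whence on a good orbit dilute on `[0, t]`:
  `|KfunA(τ)| ≤ 4 C_A K η_Z ε t + (4 C_A K η_Z/ε) ∫₀ᵗ∫ (ΣD̄² + |q̄|²)`.
* IN PROBABILITY: `σ₀ := min σ_ceil (1/2)` with `σ_ceil` from `ceilingAllTimes_const` at level `η_Z`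
  (dilute event `→ 0`) and the kinetic closure at equilibrium `fmr_rung0` (`∫₀ᵗ∫(ΣD̄² + |q̄|²) ≤ δ'`
  off an event `→ 0`); choosing `ε`, then `δ'`, from `δ` makes the deterministic bound `≤ 2δ/3` on the
  good set off the two bad events; union bound (`measure_le_of_imp2`) and squeeze.
References (background only; the estimate is folklore): Chapman–Cowling 1970 §16.4; Spohn 1991 I §3.
-/

namespace Summit.AtomisticToContinuum.HydrodynamicLimit.Theorems.HemisphereAffineSlaving

open scoped BigOperators Topology Classical ENNReal InnerProductSpace
open Filter Set Function MeasureTheory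

noncomputable section

open Literature.MathematicalPhysics.KineticTheory (T3 V3)

namespace KfunAConst

open Literature.MathematicalPhysics.KineticTheory (hsCompressibility localGibbsLaw)
open Literature.Analysis.FluidPDE (configEnergy)

variable {N : ℕ}

/-! ### The pointwise AM–GM envelope -/

/-- **Pointwise.** On a block with `ρ̄σ³ ≤ η₁`, for `|Z(η) − 1| ≤ Kη` on `[0, η₁]`, `|A_ab| ≤ C_A`
(`C_A ≥ 0`) and every `ε > 0`:
`|kinWA · p_c(ρ̄, θ̄)| ≤ 4 C_A K η₁ ε + (4 C_A K η₁/ε)(ΣD̄² + |q̄|²)`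
(`kinWA · p_c = (2/5)(D̄ : A)(Z − 1)` off the guard `pkin = 0`, `0` on it; AM–GM `abs_le_eps`). [folklore] -/
theorem abs_kinWA_mul_pcoll_le_eps {φ : ℕ → T3 → ℝ} {s : ℝ} {w : Cfg N} {x : T3}
    {σ K η₁ CA ε : ℝ} (hφ0 : ∀ y, 0 ≤ φ N y) (hσ : 0 < σ) (hK : 0 ≤ K) (hε : 0 < ε)
    (hCA : 0 ≤ CA) (hZ : ∀ η : ℝ, 0 ≤ η → η ≤ η₁ → |hsCompressibility η - 1| ≤ K * η)
    {A : ℝ → T3 → Fin 3 → Fin 3 → ℝ} (hA : ∀ a b, |A s x a b| ≤ CA)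
    (hhi : rhoB φ N w x * σ ^ 3 ≤ η₁) :
    |kinWA A φ N s w x * pcoll σ (rhoB φ N w x) (thetaB φ N w x)| ≤
      4 * CA * K * η₁ * ε +
        4 * CA * K * η₁ / ε * ((∑ j, ∑ k, Dst φ N w x j k ^ 2) + ‖qfl φ N w x‖ ^ 2) := by
  have hρ0 : 0 ≤ rhoB φ N w x := rhoB_nonneg hφ0
  have hη0 : 0 ≤ rhoB φ N w x * σ ^ 3 := by positivity
  have hη₁0 : 0 ≤ η₁ := hη0.trans hhi
  have hZm : |hsCompressibility (rhoB φ N w x * σ ^ 3) - 1| ≤ K * η₁ :=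
    (hZ _ hη0 hhi).trans (mul_le_mul_of_nonneg_left hhi hK)
  set Pf := ((∑ j, ∑ k, Dst φ N w x j k ^ 2) + ‖qfl φ N w x‖ ^ 2) with hPf
  have hP0 : 0 ≤ Pf := by positivity
  have hDsq : ∀ a b, Dst φ N w x a b ^ 2 ≤ Pf := fun a b => by
    calc Dst φ N w x a b ^ 2 ≤ ∑ k, Dst φ N w x a k ^ 2 :=
          Finset.single_le_sum (f := fun k => Dst φ N w x a k ^ 2) (fun k _ => sq_nonneg _)
            (Finset.mem_univ b)
      _ ≤ ∑ j, ∑ k, Dst φ N w x j k ^ 2 :=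
          Finset.single_le_sum (f := fun j => ∑ k, Dst φ N w x j k ^ 2)
            (fun j _ => Finset.sum_nonneg fun k _ => sq_nonneg _) (Finset.mem_univ a)
      _ ≤ Pf := le_add_of_nonneg_right (sq_nonneg _)
  have hS : |∑ a, ∑ b, Dst φ N w x a b * A s x a b| ≤ 9 * ((ε + Pf / ε) * CA) := by
    calc |∑ a, ∑ b, Dst φ N w x a b * A s x a b|
        ≤ ∑ a, ∑ b, |Dst φ N w x a b * A s x a b| :=
          (Finset.abs_sum_le_sum_abs _ _).trans (Finset.sum_le_sum fun a _ =>
            Finset.abs_sum_le_sum_abs _ _)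
      _ ≤ ∑ _a : Fin 3, ∑ _b : Fin 3, (ε + Pf / ε) * CA := by
          refine Finset.sum_le_sum fun a _ => Finset.sum_le_sum fun b _ => ?_
          rw [abs_mul]
          exact mul_le_mul (abs_le_eps hε (hDsq a b)) (hA a b) (abs_nonneg _) (by positivity)
      _ = 9 * ((ε + Pf / ε) * CA) := by simp [Finset.sum_const]; ring
  have hrhs : 0 ≤ 4 * CA * K * η₁ * ε + 4 * CA * K * η₁ / ε * Pf := by positivity
  rw [RhsEnvelope.pcoll_eq_pkin_mul]
  unfold kinWA
  set P := pkin φ N w x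
  set S := ∑ a, ∑ b, Dst φ N w x a b * A s x a b
  set Zm := hsCompressibility (rhoB φ N w x * σ ^ 3) - 1
  by_cases hP : P = 0
  · rw [hP, div_zero, zero_mul, abs_zero]
    exact hrhs
  · have h : 2 / 5 * S / P * (P * Zm) = 2 / 5 * S * Zm := by
      field_simp
    rw [h, abs_mul, abs_mul, abs_of_pos (by norm_num : (0 : ℝ) < 2 / 5)]
    have hX : 0 ≤ CA * K * η₁ * (ε + Pf / ε) := by positivity
    calc 2 / 5 * |S| * |Zm| ≤ 2 / 5 * (9 * ((ε + Pf / ε) * CA)) * (K * η₁) :=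
          mul_le_mul (mul_le_mul_of_nonneg_left hS (by norm_num)) hZm (abs_nonneg _)
            (by positivity)
      _ = (18 / 5) * (CA * K * η₁ * (ε + Pf / ε)) := by ring
      _ ≤ 4 * (CA * K * η₁ * (ε + Pf / ε)) := by nlinarith [hX]
      _ = 4 * CA * K * η₁ * ε + 4 * CA * K * η₁ / ε * Pf := by ring

/-! ### Integration in `x` and in `s` -/

/-- `x`-integration of the pointwise envelope:
`‖∫ₓ kinWA · p_c‖ ≤ 4 C_A K η₁ ε + (4 C_A K η₁/ε) ∫ₓ (ΣD̄² + |q̄|²)` (honest dominating integrand: the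
kinetic integrand is measurable and bounded, `measurable_kineticIntegrand`, `kineticIntegrand_le`; the
torus has volume one). [folklore] -/
theorem norm_integral_kin_le {φ : ℕ → T3 → ℝ} {s : ℝ} {w : Cfg N} {σ K η₁ CA ε Φb : ℝ}
    (hφc : Continuous (φ N)) (hφ0 : ∀ y, 0 ≤ φ N y) (hφb : ∀ y, φ N y ≤ Φb) (hσ : 0 < σ)
    (hK : 0 ≤ K) (hε : 0 < ε) (hCA : 0 ≤ CA)
    (hZ : ∀ η : ℝ, 0 ≤ η → η ≤ η₁ → |hsCompressibility η - 1| ≤ K * η)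
    {A : ℝ → T3 → Fin 3 → Fin 3 → ℝ} (hA : ∀ (x : T3) (a b : Fin 3), |A s x a b| ≤ CA)
    (hhi : ∀ x, rhoB φ N w x * σ ^ 3 ≤ η₁) :
    ‖∫ x, kinWA A φ N s w x * pcoll σ (rhoB φ N w x) (thetaB φ N w x)‖ ≤
      4 * CA * K * η₁ * ε +
        4 * CA * K * η₁ / ε * ∫ x, ((∑ j, ∑ k, Dst φ N w x j k ^ 2) + ‖qfl φ N w x‖ ^ 2) := by
  set Vb : ℝ := ∑ i, ‖(w i).2‖ with hVb_def
  have hVb : 0 ≤ Vb := Finset.sum_nonneg fun i _ => norm_nonneg _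
  have hV : ∀ i, ‖(w i).2‖ ≤ Vb := fun i =>
    Finset.single_le_sum (f := fun i => ‖(w i).2‖) (fun i _ => norm_nonneg _) (Finset.mem_univ i)
  have hPint : Integrable (fun x => ((∑ j, ∑ k, Dst φ N w x j k ^ 2) + ‖qfl φ N w x‖ ^ 2)) := by
    refine Integrable.mono' (integrable_const (9 * (8 * Φb * Vb ^ 2) ^ 2 + (4 * Φb * Vb ^ 3) ^ 2))
      ((measurable_kineticIntegrand φ N hφc).comp
        (measurable_const.prodMk measurable_id)).aestronglyMeasurable
      (ae_of_all _ fun x => ?_)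
    rw [Real.norm_eq_abs, abs_of_nonneg (by positivity)]
    exact kineticIntegrand_le hφ0 hφb hVb hV
  set L := 4 * CA * K * η₁ with hL
  have hgi : Integrable (fun x => L * ε +
      L / ε * ((∑ j, ∑ k, Dst φ N w x j k ^ 2) + ‖qfl φ N w x‖ ^ 2)) :=
    (integrable_const _).add (hPint.const_mul _)
  refine (norm_integral_le_of_norm_le hgi (ae_of_all _ fun x => ?_)).trans (le_of_eq ?_)
  · rw [Real.norm_eq_abs]
    exact abs_kinWA_mul_pcoll_le_eps hφ0 hσ hK hε hCA hZ (hA x) (hhi x)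
  · rw [integral_add (integrable_const _) (hPint.const_mul _), integral_const, integral_const_mul]
    simp

section OrbitK

variable {σ : ℝ} (Φ : Flows σ) {z : Cfg N} (hz : z ∈ (Φ N).good)
include hz

/-- **The pathwise bound on `KfunA`** on a good orbit with `ρ̄σ³ ≤ η₁` on `[0, t] × 𝕋³`,
`|A_ab| ≤ C_A` on `[0, t] × 𝕋³`, `|Z(η) − 1| ≤ Kη` on `[0, η₁]`, `ε > 0`, `τ ∈ [0, t]`:
`|KfunA(z, τ)| ≤ 4 C_A K η₁ ε t + (4 C_A K η₁/ε) ∫₀ᵗ∫ₓ (ΣD̄² + |q̄|²)` (the nonnegative slice bound is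
integrated over `[0, τ] ⊆ [0, t]`; the kinetic integrand is bounded along the orbit by energy
conservation, `norm_vel_orbit_le`). [folklore] -/
theorem abs_KfunA_dilute_le {φ : ℕ → T3 → ℝ} {t K η₁ CA ε Φb : ℝ} (hφc : Continuous (φ N))
    (hφ0 : ∀ y, 0 ≤ φ N y) (hφb : ∀ y, φ N y ≤ Φb) (hσ : 0 < σ) (hK : 0 ≤ K) (hη₁ : 0 ≤ η₁)
    (hε : 0 < ε) (hCA : 0 ≤ CA)
    (hZ : ∀ η : ℝ, 0 ≤ η → η ≤ η₁ → |hsCompressibility η - 1| ≤ K * η)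
    {A : ℝ → T3 → Fin 3 → Fin 3 → ℝ} (hA : ∀ s ∈ Icc 0 t, ∀ (x : T3) (a b : Fin 3), |A s x a b| ≤ CA)
    (hhi : ∀ s ∈ Icc 0 t, ∀ x, rhoB φ N ((Φ N).flow s z) x * σ ^ 3 ≤ η₁) {τ : ℝ}
    (hτ : τ ∈ Icc 0 t) :
    |KfunA σ Φ φ A N z τ| ≤
      4 * CA * K * η₁ * ε * t +
        4 * CA * K * η₁ / ε *
          ∫ s in Icc 0 t, ∫ x, ((∑ j, ∑ k, Dst φ N ((Φ N).flow s z) x j k ^ 2) +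
            ‖qfl φ N ((Φ N).flow s z) x‖ ^ 2) := by
  set Aε := 4 * CA * K * η₁ * ε with hAε
  set Cc := 4 * CA * K * η₁ / ε with hCc
  set G : ℝ → ℝ := fun s =>
    ∫ x, ((∑ j, ∑ k, Dst φ N ((Φ N).flow s z) x j k ^ 2) + ‖qfl φ N ((Φ N).flow s z) x‖ ^ 2) with hG
  have hA0 : 0 ≤ Aε := by positivity
  have hCc0 : 0 ≤ Cc := by positivity
  have hVb : 0 ≤ Real.sqrt (2 * configEnergy z) := Real.sqrt_nonneg _
  have hG0 : ∀ s, 0 ≤ G s := fun s => integral_nonneg fun x => by positivity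
  have hGm : Measurable G := by
    have hg : Measurable fun q : ℝ × T3 => (((Φ N).flow q.1 z, q.2) : Cfg N × T3) :=
      ((measurable_orbit Φ hz).comp measurable_fst).prodMk measurable_snd
    have hj : Measurable ((fun p : Cfg N × T3 =>
        ((∑ j, ∑ k, Dst φ N p.1 p.2 j k ^ 2) + ‖qfl φ N p.1 p.2‖ ^ 2)) ∘
        fun q : ℝ × T3 => (((Φ N).flow q.1 z, q.2) : Cfg N × T3)) :=
      (measurable_kineticIntegrand φ N hφc).comp hg
    exact hj.stronglyMeasurable.integral_prod_right'.measurable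
  set M : ℝ := 9 * (8 * Φb * Real.sqrt (2 * configEnergy z) ^ 2) ^ 2 +
    (4 * Φb * Real.sqrt (2 * configEnergy z) ^ 3) ^ 2 with hM
  have hGb : ∀ s, ‖G s‖ ≤ M := fun s => by
    refine (norm_integral_le_of_norm_le (integrable_const M) (ae_of_all _ fun x => ?_)).trans ?_
    · rw [Real.norm_eq_abs, abs_of_nonneg (by positivity)]
      exact kineticIntegrand_le hφ0 hφb hVb (norm_vel_orbit_le Φ hz s)
    · simp
  have hGi : IntegrableOn G (Icc 0 t) :=
    Measure.integrableOn_of_bounded measure_Icc_lt_top.ne hGm.aestronglyMeasurable (ae_of_all _ hGb)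
  have hBi : IntegrableOn (fun s => Aε + Cc * G s) (Icc 0 t) :=
    (integrableOn_const measure_Icc_lt_top.ne).add (hGi.const_mul Cc)
  have ht0 : 0 ≤ t := hτ.1.trans hτ.2
  unfold KfunA
  rw [← Real.norm_eq_abs]
  calc ‖∫ s in Icc 0 τ, ∫ x, kinWA A φ N s ((Φ N).flow s z) x *
        pcoll σ (rhoB φ N ((Φ N).flow s z) x) (thetaB φ N ((Φ N).flow s z) x)‖
      ≤ ∫ s in Icc 0 τ, (Aε + Cc * G s) := by
        refine norm_integral_le_of_norm_le (hBi.mono_set (Icc_subset_Icc_right hτ.2))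
          (ae_restrict_of_forall_mem measurableSet_Icc fun s hs => ?_)
        have hs' : s ∈ Icc 0 t := ⟨hs.1, hs.2.trans hτ.2⟩
        exact norm_integral_kin_le hφc hφ0 hφb hσ hK hε hCA hZ (hA s hs') (hhi s hs')
    _ ≤ ∫ s in Icc 0 t, (Aε + Cc * G s) :=
        setIntegral_mono_set hBi (ae_of_all _ fun s => add_nonneg hA0 (mul_nonneg hCc0 (hG0 s)))
          (Icc_subset_Icc_right hτ.2).eventuallyLE
    _ = Aε * t + Cc * ∫ s in Icc 0 t, G s := by
        have hAi : IntegrableOn (fun _ : ℝ => Aε) (Icc 0 t) :=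
          integrableOn_const measure_Icc_lt_top.ne
        rw [integral_add hAi (hGi.const_mul Cc), setIntegral_const, integral_const_mul]
        simp [Measure.real, Real.volume_Icc, ht0, mul_comm]

end OrbitK

/-! ### Bookkeeping -/

/-- Uniform component bound of a matrix weight smooth on `[0, t]`: `|A(s, x)_ab| ≤ C_A` on
`[0, t] × 𝕋³` (`IsSmoothSpaceTimeOn.exists_norm_le_of_isCompact` componentwise). [folklore] -/
theorem exists_bound_of_smoothMatrixOn {t : ℝ} {A : ℝ → T3 → Fin 3 → Fin 3 → ℝ}
    (hA : SmoothMatrixOn (Icc 0 t) A) :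
    ∃ CA : ℝ, 0 ≤ CA ∧ ∀ s ∈ Icc 0 t, ∀ (x : T3) (a b : Fin 3), |A s x a b| ≤ CA := by
  have h : ∀ a b : Fin 3, ∃ C : ℝ, ∀ s ∈ Icc 0 t, ∀ x : T3, ‖A s x a b‖ ≤ C := fun a b =>
    (hA a b).exists_norm_le_of_isCompact isCompact_Icc Subset.rfl
  choose Cab hCab using h
  refine ⟨∑ a, ∑ b, |Cab a b|, by positivity, fun s hs x a b => ?_⟩
  calc |A s x a b| ≤ |Cab a b| := by
        rw [← Real.norm_eq_abs (A s x a b)]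
        exact (hCab a b s hs x).trans (le_abs_self _)
    _ ≤ ∑ b', |Cab a b'| :=
        Finset.single_le_sum (f := fun b' => |Cab a b'|) (fun _ _ => abs_nonneg _) (Finset.mem_univ b)
    _ ≤ ∑ a', ∑ b', |Cab a' b'| :=
        Finset.single_le_sum (f := fun a' => ∑ b', |Cab a' b'|)
          (fun _ _ => Finset.sum_nonneg fun _ _ => abs_nonneg _) (Finset.mem_univ a)

/-- Union bound over two bad events off a null set. [folklore] -/
theorem measure_le_of_imp2 {Ω : Type*} [MeasurableSpace Ω] (P : Measure Ω) {G B W F : Set Ω}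
    (hG : P Gᶜ = 0) (h : ∀ z ∈ B, z ∈ G → z ∉ W → z ∈ F) : P B ≤ P W + P F := by
  calc P B ≤ P (Gᶜ ∪ (W ∪ F)) := measure_mono fun z hz => by
        by_cases hzG : z ∈ G
        · by_cases hW : z ∈ W
          · exact Or.inr (Or.inl hW)
          exact Or.inr (Or.inr (h z hz hzG hW))
        · exact Or.inl hzG
    _ ≤ P Gᶜ + (P W + P F) :=
        (measure_union_le _ _).trans (add_le_add le_rfl (measure_union_le _ _))
    _ = P W + P F := by rw [hG, zero_add]

end KfunAConst

open KfunAConst in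
/-- **Registered stub [K0A] `stub_kfunA_const` (line hemisphere-affine-slaving, crux
stmt-AtomisticToContinuum-9518): THE KINETIC CORRECTION `KfunA` VANISHES AT GLOBAL EQUILIBRIUM,
mesoscale kernel.** For every `θ > 0` there is `σ₀ > 0` (`min σ_ceil (1/2)`, `σ_ceil` from
`ceilingAllTimes_const` at the level `η_Z` of `stub_hsCompressibility_linear`) such that for
`0 < σ < σ₀`, every flow family, `t > 0`, admissible kernel family, matrix weight `A` smooth on `[0, t]`,
fixed `τ ∈ [0, t]` and `δ > 0`: `P_N{δ < |KfunA_N(τ)|} → 0` under the homogeneous local Gibbs law (on the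
good set off the dilute event and the kinetic-closure event `fmr_rung0` the pathwise bound
`abs_KfunA_dilute_le` is `≤ 2δ/3` for `ε`, `δ'` chosen from `δ`; union bound and squeeze). [folklore] -/
theorem stub_kfunA_const : ∀ θ : ℝ, 0 < θ → ∃ σ₀ : ℝ, 0 < σ₀ ∧ ∀ σ : ℝ, 0 < σ → σ < σ₀ → ∀ (Φ : Flows σ) (t : ℝ), 0 < t → ∀ (γ C : ℝ) (φ : ℕ → T3 → ℝ), 0 < γ → γ ≤ 1 / 15 → AdmissibleKernel γ C φ → ∀ (A : ℝ → T3 → Fin 3 → Fin 3 → ℝ), SmoothMatrixOn (Icc 0 t) A → ∀ τ ∈ Icc 0 t, ∀ δ : ℝ, 0 < δ → Tendsto (fun N : ℕ => Literature.MathematicalPhysics.KineticTheory.localGibbsLaw σ (fun _ => 1) (fun _ => 0) (fun _ => θ) N (Φ N) {z | δ < |KfunA σ Φ φ A N z τ|}) atTop (𝓝 0) := by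
  intro θ hθ
  obtain ⟨ηZ, hηZ, K, hK, hZ⟩ := stub_hsCompressibility_linear
  obtain ⟨σ₁, hσ₁, Hceil⟩ := ceilingAllTimes_const ηZ hηZ θ hθ
  refine ⟨min σ₁ (1 / 2), lt_min hσ₁ (by norm_num), ?_⟩
  intro σ hσ hlt Φ t ht γ C φ hγ hγ' hadm A hA τ hτ δ hδ
  have hlt₁ : σ < σ₁ := lt_of_lt_of_le hlt (min_le_left _ _)
  have hhalf : σ ≤ 1 / 2 := (lt_of_lt_of_le hlt (min_le_right _ _)).le
  -- the component bound of `A` and the budget `ε`, `δ'`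
  obtain ⟨CA, hCA0, hCA⟩ := exists_bound_of_smoothMatrixOn hA
  set L : ℝ := 4 * CA * K * ηZ + 1 with hL
  have hL0 : 0 < L := by positivity
  have hle : 4 * CA * K * ηZ ≤ L := by rw [hL]; linarith
  set ε : ℝ := δ / (3 * L * t) with hε
  have hε0 : 0 < ε := by positivity
  set δ' : ℝ := δ * ε / (3 * L) with hδ'
  have hδ'0 : 0 < δ' := by positivity
  -- the two bad events
  have hF := fmr_rung0 σ hσ hhalf θ hθ Φ γ C φ hγ hγ' hadm t ht δ' hδ'0
  have hDilT : Tendsto (fun N : ℕ =>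
      Literature.MathematicalPhysics.KineticTheory.localGibbsLaw σ (fun _ => 1) (fun _ => 0) (fun _ => θ)
        N (Φ N) {z | ∃ s ∈ Icc 0 t, ∃ x : T3, ηZ < rhoB φ N ((Φ N).flow s z) x * σ ^ 3}) atTop (𝓝 0) :=
    Hceil σ hσ hlt₁ Φ t ht γ C φ hγ hγ' hadm
  have hlim := hDilT.add hF
  rw [add_zero] at hlim
  refine tendsto_of_tendsto_of_tendsto_of_le_of_le tendsto_const_nhds hlim (fun _ => zero_le)
    fun N => ?_
  -- the union bound at fixed `N`
  have hφc : Continuous (φ N) := (hadm.1 N).continuous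
  have hφ0 : ∀ y, 0 ≤ φ N y := hadm.2.1 N
  have hφb : ∀ y, φ N y ≤ C * ((N : ℝ) + 1) ^ (3 * γ) := hadm.2.2.2.2.1 N
  refine measure_le_of_imp2 _ (localGibbsLaw_compl_good' (Φ N)) fun z hz hzg hw => ?_
  by_contra hfmr
  simp only [Set.mem_setOf_eq, not_exists, not_lt, not_and] at hw hfmr hz
  have hhi : ∀ s ∈ Icc 0 t, ∀ x, rhoB φ N ((Φ N).flow s z) x * σ ^ 3 ≤ ηZ := fun s hs x => hw s hs x
  have hKf := abs_KfunA_dilute_le Φ hzg hφc hφ0 hφb hσ hK hηZ.le hε0 hCA0 hZ hCA hhi hτ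
  set I := ∫ s in Icc 0 t, ∫ x, ((∑ j, ∑ k, Dst φ N ((Φ N).flow s z) x j k ^ 2) +
    ‖qfl φ N ((Φ N).flow s z) x‖ ^ 2) with hI
  have hI0 : 0 ≤ I := integral_nonneg fun s => integral_nonneg fun x => by positivity
  have h1 : 4 * CA * K * ηZ * ε * t ≤ δ / 3 := by
    calc 4 * CA * K * ηZ * ε * t ≤ L * ε * t :=
          mul_le_mul_of_nonneg_right (mul_le_mul_of_nonneg_right hle hε0.le) ht.le
      _ = δ / 3 := by rw [hε]; field_simp
  have h2 : 4 * CA * K * ηZ / ε * I ≤ δ / 3 := by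
    calc 4 * CA * K * ηZ / ε * I ≤ L / ε * δ' :=
          mul_le_mul (div_le_div_of_nonneg_right hle hε0.le) hfmr hI0 (by positivity)
      _ = δ / 3 := by rw [hδ']; field_simp
  linarith

end

end Summit.AtomisticToContinuum.HydrodynamicLimit.Theorems.HemisphereAffineSlaving
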